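import Summits.HubbardSuperconductivity.HubbardSuperconductivity.Theorems.ParityGapRigidityDoublonDeficit
import Summits.HubbardSuperconductivity.HubbardSuperconductivity.Theorems.ParityGapRigidityMomentumDistribution
import Literature.Probability.LatticeModels.TorusL1Poincare
import HarnessLib

/-!
# Route ParityGapRigidity — crux `GappedWindow` (stmt-HubbardSuperconductivity-2196):
# every parity-gapped window has extensive momentum smearing and an extensive doublon deficit

Helper file (`--supports stmt-HubbardSuperconductivity-2198`, the route's kill criterion; periphery
of the crux stmt-2196, line `registered`, lead c6, cycle 2). Three earlier results are composed:

1. lead c5: the (PG) clause makes the Bloch occupations `n_σ(k)` of every `(N_L, 0)`-sector ground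
   state `K/L`-Lipschitz on the dual torus (`momentumDistribution_lipschitz_of_parityGap_clause`,
   through the now-proved sector-relative Hastings–Koma lemma stmt-2197);
2. the elementary torus fact `Literature.Probability.LatticeModels.sum_mul_one_sub_ge_of_lipschitz_pi`
   (discrete `ℓ¹`-Poincaré on `(ℤ/Lℤ)²`): a `K/L`-Lipschitz density in `[0,1]` with total mass
   between `L²/8` and `L²/2` has `Σ_k n_k(1-n_k) ≥ L²/(1502K + 256)`;
3. lead c6: the exact identity `PG · Σ_k n_k(1-n_k) ≤ U · (n_L²/L² - ⟨Σ_z n_{z↑}n_{z↓}⟩)`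
   (`doublonDeficit_of_parityGap_clause`).

* `smearing_extensive_of_parityGap_clause` — the (PG) clause at `(U, δ)`, `0 < δ < 1/2`, gives
  `s₀ > 0` and `L₀` with `Σ_k n_{k↑}(1 - n_{k↑}) ≥ s₀ L²` for every normalised `(N_L, 0)`-sector ground
  state at even `L ≥ L₀` — **a window has no sharp Fermi surface even in the `ℓ²` sense**;
* `doublonDeficit_extensive_of_parityGap_clause` — with `U > 0` in addition: `d₀ > 0` and `L₀` with
  `⟨Σ_z n_{z↑}n_{z↓}⟩_ψ ≤ ⌊(1-δ)L²/2⌋²/L² - d₀ L²` — **the doublon density of a window lies strictly,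
  L-uniformly below its uncorrelated (Wick) value `(N_L/2L²)²`**;
* `gappedWindow_doublonDeficit_extensive` — the crux BY NAME ⇒ the same in its window;
* `not_parityGap_clause_of_doublonWick` — **kill-criterion instrument** (stmt-2198 at one point): if
  along infinitely many even `L` some normalised `(N_L, 0)`-sector ground state has doublon deficit
  `≤ ε L²` for every `ε > 0` (asymptotically Wick doublon density), the (PG) clause fails at `(U, δ)`;
  `not_gappedWindow_of_forall_doublonWick` — the same everywhere refutes `GappedWindow`.

Reading for planners/refuters. "No uniform parity gap without interaction-induced local correlation":
a window of the pure repulsive model must suppress double occupancy below `n_↑ n_↓` by a fixed amount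
per site. The constants are those of Hastings–Koma (`K ~ C(U,Δ)·S_m`), astronomically weak at the
Kohn–Luttinger candidate (where the true deficit is `~U` per site and the bound asks for
`~Δ/(UK) ~ e^{-c/U²}`); like every decidable statement about this crux it calibrates the clause and
does not touch the open stub S of the line (see `Cruxes/GappedWindow/Lines/registered-dead.md`).

No definitions. Sources: Hastings–Koma, CMP 265 (2006) 781; Matveev–Larkin, PRL 78 (1997) 3749;
folklore (discrete Poincaré inequality).
-/

noncomputable section

-- the mandated namespace `Summit.<Summit>.<Problem>.Theorems` repeats `HubbardSuperconductivity`
-- (single-problem summit, D-0017), which the `dupNamespace` linter flags on every declaration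
set_option linter.dupNamespace false

namespace Summit.HubbardSuperconductivity.HubbardSuperconductivity.Theorems

open Summit.HubbardSuperconductivity.HubbardSuperconductivity.Theses.ParityGapRigidity
open Literature.MathematicalPhysics.QuantumLattice Literature.Probability.LatticeModels Matrix

/-- `dist(x, x + eᵢ) ≤ 1` in the torus metric of `(ℤ/Lℤ)²`.
(adapted from `Literature.MathematicalPhysics.QuantumLattice.XYHelix.torusDist_add_single_le`, whose
module is not imported here to keep the dependency cone small) [bookkeeping] -/
theorem torusDist_add_single_le_one {L : ℕ} [NeZero L] (x : TorusSite 2 L) (i : Fin 2) :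
    torusDist x (x + Pi.single i 1) ≤ 1 := by
  rw [torusDist, torusNorm, sub_add_cancel_left]
  refine Finset.sup_le fun j _ => ?_
  by_cases hj : j = i
  · subst hj
    rw [Pi.neg_apply, Pi.single_eq_same, ZMod.neg_val, ZMod.val_one_eq_one_mod]
    split_ifs with h
    · exact (min_le_left _ _).trans (Nat.zero_le _)
    · refine (min_le_right _ _).trans ?_
      have hL1 : 1 < L := by
        by_contra hc
        push Not at hc
        have hL : L = 1 := le_antisymm hc (Nat.pos_of_ne_zero (NeZero.ne L))
        subst hL
        exact h (Subsingleton.elim _ _)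
      rw [Nat.mod_eq_of_lt hL1]
      omega
  · rw [Pi.neg_apply, Pi.single_eq_of_ne hj, neg_zero, ZMod.val_zero]
    exact (min_le_left _ _).trans (Nat.zero_le _)

/-- **A parity-gapped window has extensive momentum smearing.** The (PG) clause of `GappedWindow` at
`(U, δ)` with `0 < δ < 1/2` (any real `U`) gives `s₀ > 0` and `L₀` such that every normalised
`(N_L, S^z = 0)`-sector ground state `ψ` of `hubbardTorus 2 L 1 U` at even `L ≥ L₀` has
`Σ_k n_{k↑}(1 - n_{k↑}) ≥ s₀ · L²`, `n_{k↑} = ‖c_{k↑}ψ‖²` (`s₀ = 1/(1502K + 256)` with `K` the Lipschitz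
constant of `momentumDistribution_lipschitz_of_parityGap_clause`). -/
theorem smearing_extensive_of_parityGap_clause (U : ℝ) {δ : ℝ} (hδ : δ ∈ Set.Ioo (0 : ℝ) (1 / 2))
    (hPG : ∃ Δ : ℝ, 0 < Δ ∧ ∃ L₀ : ℕ, ∀ L ≥ L₀, Even L → ∀ Hm, Hm = hubbardTorus 2 L 1 U →
      2 * Δ ≤ groundEnergy Hm (2 * ⌊(1 - δ) * (L : ℝ) ^ 2 / 2⌋₊ + 1) +
        groundEnergy Hm (2 * ⌊(1 - δ) * (L : ℝ) ^ 2 / 2⌋₊ - 1) -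
        2 * Matrix.minEnergyOn Hm (szSector (2 * ⌊(1 - δ) * (L : ℝ) ^ 2 / 2⌋₊) 0)) :
    ∃ s₀ : ℝ, 0 < s₀ ∧ ∃ L₀ : ℕ, ∀ (L : ℕ) [NeZero L], L₀ ≤ L → Even L →
      ∀ ψ : Fock (Orb (FermionTorus 2 L)),
        IsGroundStateInSector (hubbardTorus 2 L 1 U) (2 * ⌊(1 - δ) * (L : ℝ) ^ 2 / 2⌋₊) 0 ψ →
        star ψ ⬝ᵥ ψ = 1 →
        s₀ * (L : ℝ) ^ 2 ≤ ∑ k : TorusSite 2 L,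
          (star (momentumAnnihilation k 0 *ᵥ ψ) ⬝ᵥ (momentumAnnihilation k 0 *ᵥ ψ)).re *
            (1 - (star (momentumAnnihilation k 0 *ᵥ ψ) ⬝ᵥ (momentumAnnihilation k 0 *ᵥ ψ)).re) := by
  obtain ⟨K, hK, L₀, hlip⟩ := momentumDistribution_lipschitz_of_parityGap_clause U δ hPG
  refine ⟨1 / (1502 * K + 256), by positivity, max L₀ (max 3 ⌈2 * K⌉₊), ?_⟩
  intro L _ hL hev ψ hgs hψ1
  have hL0 : L₀ ≤ L := le_of_max_le_left hL
  have hL3 : 3 ≤ L := le_of_max_le_left (le_of_max_le_right hL)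
  have hLK : ⌈2 * K⌉₊ ≤ L := le_of_max_le_right (le_of_max_le_right hL)
  have hLr : (0 : ℝ) < L := Nat.cast_pos.2 (by omega)
  have h2K : 2 * K ≤ L := (Nat.le_ceil _).trans (by exact_mod_cast hLK)
  set n : ℕ := ⌊(1 - δ) * (L : ℝ) ^ 2 / 2⌋₊ with hn
  -- the occupation function and its basic properties
  set f : TorusSite 2 L → ℝ := fun k =>
    (star (momentumAnnihilation k 0 *ᵥ ψ) ⬝ᵥ (momentumAnnihilation k 0 *ᵥ ψ)).re with hf
  have hfexp : ∀ k, f k = (expect (momentumNumber k 0) ψ).re := fun k => by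
    simp only [hf, expect]; rw [star_dotProduct_momentumNumber_mulVec]
  have hf01 : ∀ k, 0 ≤ f k ∧ f k ≤ 1 := fun k => by
    have h := re_expect_momentumNumber_mem_Icc k 0 ψ
    rw [star_dotProduct_momentumNumber_mulVec, hψ1, Complex.one_re] at h
    exact ⟨h.1, h.2⟩
  have hsec : IsInSector n n ψ := (mem_szSector_two_mul_zero_iff n ψ).1 hgs.1
  have hsum : ∑ k, f k = n := by
    have h := sum_re_expect_momentumNumber_up (L := L) hsec
    rw [hψ1, Complex.one_re, mul_one] at h
    rw [← h]
    refine Finset.sum_congr rfl fun k _ => ?_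
    simp only [hf]; rw [star_dotProduct_momentumNumber_mulVec]
  -- `L²/8 ≤ n ≤ L²/2`
  have hδ0 : 0 ≤ 1 - δ := by linarith [hδ.2]
  have hnle : (n : ℝ) ≤ (L : ℝ) ^ 2 / 2 := by
    have h1 : (n : ℝ) ≤ (1 - δ) * (L : ℝ) ^ 2 / 2 := Nat.floor_le (by positivity)
    have h2 : (1 - δ) * (L : ℝ) ^ 2 / 2 ≤ (L : ℝ) ^ 2 / 2 := by
      have : 0 ≤ δ * (L : ℝ) ^ 2 := by have := hδ.1; positivity
      linarith
    exact h1.trans h2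
  have hnge : (L : ℝ) ^ 2 / 8 ≤ n := by
    have h1 : (1 - δ) * (L : ℝ) ^ 2 / 2 < n + 1 := Nat.lt_floor_add_one _
    have hL3r : (3 : ℝ) ≤ L := by exact_mod_cast hL3
    have hδ2 := hδ.2
    nlinarith
  -- Lipschitz on the edges of the dual torus
  have hlipE : ∀ (k : TorusSite 2 L) (i : Fin 2), |f (k + Pi.single i 1) - f k| ≤ K / L := by
    intro k i
    have h := hlip L hL0 hev ψ hgs hψ1 0 (k + Pi.single i 1) k
    rw [← hfexp, ← hfexp] at h
    refine h.trans ?_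
    rw [div_le_div_iff_of_pos_right hLr]
    calc K * (torusDist (k + Pi.single i 1) k : ℝ) ≤ K * 1 := by
          refine mul_le_mul_of_nonneg_left ?_ hK
          rw [torusDist_comm']
          exact_mod_cast torusDist_add_single_le_one k i
      _ = K := mul_one K
  have key := sum_mul_one_sub_ge_of_lipschitz_pi f (fun k => (hf01 k).1) (fun k => (hf01 k).2)
    (by rw [hsum]; exact hnge) (by rw [hsum]; exact hnle) hK h2K hlipE
  rw [one_div_mul_eq_div]
  exact key

/-- **A parity-gapped window of the repulsive model has an extensive doublon deficit.** The (PG)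
clause of `GappedWindow` at `(U, δ)` with `U > 0`, `0 < δ < 1/2` gives `d₀ > 0` and `L₀` such that every
normalised `(N_L, 0)`-sector ground state `ψ` of `hubbardTorus 2 L 1 U` at even `L ≥ L₀` has
`Re⟨ψ, Σ_z n_{z↑}n_{z↓} ψ⟩ ≤ ⌊(1-δ)L²/2⌋² / L² - d₀ · L²`: its doublon density lies strictly and
`L`-uniformly below the uncorrelated value `(N_L/(2L²))²`. -/
theorem doublonDeficit_extensive_of_parityGap_clause {U δ : ℝ} (hU : 0 < U)
    (hδ : δ ∈ Set.Ioo (0 : ℝ) (1 / 2))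
    (hPG : ∃ Δ : ℝ, 0 < Δ ∧ ∃ L₀ : ℕ, ∀ L ≥ L₀, Even L → ∀ Hm, Hm = hubbardTorus 2 L 1 U →
      2 * Δ ≤ groundEnergy Hm (2 * ⌊(1 - δ) * (L : ℝ) ^ 2 / 2⌋₊ + 1) +
        groundEnergy Hm (2 * ⌊(1 - δ) * (L : ℝ) ^ 2 / 2⌋₊ - 1) -
        2 * Matrix.minEnergyOn Hm (szSector (2 * ⌊(1 - δ) * (L : ℝ) ^ 2 / 2⌋₊) 0)) :
    ∃ d₀ : ℝ, 0 < d₀ ∧ ∃ L₀ : ℕ, ∀ (L : ℕ) [NeZero L], L₀ ≤ L → Even L →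
      ∀ ψ : Fock (Orb (FermionTorus 2 L)),
        IsGroundStateInSector (hubbardTorus 2 L 1 U) (2 * ⌊(1 - δ) * (L : ℝ) ^ 2 / 2⌋₊) 0 ψ →
        star ψ ⬝ᵥ ψ = 1 →
        (star ψ ⬝ᵥ ((∑ z : FermionTorus 2 L, numberOp z 0 * numberOp z 1) *ᵥ ψ)).re ≤
          ((⌊(1 - δ) * (L : ℝ) ^ 2 / 2⌋₊ : ℕ) : ℝ) ^ 2 / (L : ℝ) ^ 2 - d₀ * (L : ℝ) ^ 2 := by
  obtain ⟨s₀, hs₀, L₁, hsm⟩ := smearing_extensive_of_parityGap_clause U hδ hPG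
  obtain ⟨Δ, hΔ, L₂, hdef⟩ := doublonDeficit_of_parityGap_clause U δ hPG
  refine ⟨2 * Δ * s₀ / U, by positivity, max L₁ L₂, ?_⟩
  intro L _ hL hev ψ hgs hψ1
  have h1 := hsm L (le_of_max_le_left hL) hev ψ hgs hψ1
  have h2 := hdef L (le_of_max_le_right hL) hev ψ hgs hψ1
  -- `2Δ s₀ L² ≤ 2Δ · smearing ≤ U · deficit`
  have h3 : 2 * Δ * (s₀ * (L : ℝ) ^ 2) ≤ U * (((⌊(1 - δ) * (L : ℝ) ^ 2 / 2⌋₊ : ℕ) : ℝ) ^ 2 / (L : ℝ) ^ 2 -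
      (star ψ ⬝ᵥ ((∑ z : FermionTorus 2 L, numberOp z 0 * numberOp z 1) *ᵥ ψ)).re) :=
    (mul_le_mul_of_nonneg_left h1 (by positivity)).trans h2
  have h4 : 2 * Δ * s₀ / U * (L : ℝ) ^ 2 = 2 * Δ * (s₀ * (L : ℝ) ^ 2) / U := by ring
  have h5 : 2 * Δ * (s₀ * (L : ℝ) ^ 2) / U ≤ ((⌊(1 - δ) * (L : ℝ) ^ 2 / 2⌋₊ : ℕ) : ℝ) ^ 2 / (L : ℝ) ^ 2 -
      (star ψ ⬝ᵥ ((∑ z : FermionTorus 2 L, numberOp z 0 * numberOp z 1) *ᵥ ψ)).re := by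
    rw [div_le_iff₀ hU]
    linarith [h3]
  rw [h4]
  linarith [h5]

/-- **`GappedWindow` ⇒ an extensive doublon deficit in its window** (the crux BY NAME): there are
`U > 0`, `δ ∈ (0, 1/2)`, `d₀ > 0` and `L₀` such that every normalised `(N_L, 0)`-sector ground state at
even `L ≥ L₀` has `Re⟨ψ, Σ_z n_{z↑}n_{z↓} ψ⟩ ≤ ⌊(1-δ)L²/2⌋²/L² - d₀ L²`. -/
theorem gappedWindow_doublonDeficit_extensive (hW : GappedWindow) :
    ∃ U : ℝ, 0 < U ∧ ∃ δ ∈ Set.Ioo (0 : ℝ) (1 / 2), ∃ d₀ : ℝ, 0 < d₀ ∧ ∃ L₀ : ℕ,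
      ∀ (L : ℕ) [NeZero L], L₀ ≤ L → Even L →
        ∀ ψ : Fock (Orb (FermionTorus 2 L)),
          IsGroundStateInSector (hubbardTorus 2 L 1 U) (2 * ⌊(1 - δ) * (L : ℝ) ^ 2 / 2⌋₊) 0 ψ →
          star ψ ⬝ᵥ ψ = 1 →
          (star ψ ⬝ᵥ ((∑ z : FermionTorus 2 L, numberOp z 0 * numberOp z 1) *ᵥ ψ)).re ≤
            ((⌊(1 - δ) * (L : ℝ) ^ 2 / 2⌋₊ : ℕ) : ℝ) ^ 2 / (L : ℝ) ^ 2 - d₀ * (L : ℝ) ^ 2 := by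
  obtain ⟨U, hU, δ, hδ, hPG, -⟩ := hW
  obtain ⟨d₀, hd₀, L₀, h⟩ := doublonDeficit_extensive_of_parityGap_clause hU hδ hPG
  exact ⟨U, hU, δ, hδ, d₀, hd₀, L₀, h⟩

/-- **Asymptotically Wick doublon density refutes the (PG) clause** (sufficient condition for the
kill criterion `NoUniformParityGap`, stmt-2198, at one point `(U, δ)`, `U > 0`, `0 < δ < 1/2`): if for
every `ε > 0` and every threshold some even side beyond it carries a normalised `(N_L, 0)`-sector
ground state whose doublon deficit is at most `ε L²`,
`⌊(1-δ)L²/2⌋²/L² - Re⟨ψ, Σ_z n_{z↑}n_{z↓} ψ⟩ ≤ ε L²`, then the model has NO `L`-uniform parity gap at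
`(U, δ)`. -/
theorem not_parityGap_clause_of_doublonWick {U δ : ℝ} (hU : 0 < U) (hδ : δ ∈ Set.Ioo (0 : ℝ) (1 / 2))
    (hwick : ∀ ε : ℝ, 0 < ε → ∀ L₀ : ℕ, ∃ (L : ℕ) (_ : NeZero L), L₀ ≤ L ∧ Even L ∧
      ∃ ψ : Fock (Orb (FermionTorus 2 L)),
        IsGroundStateInSector (hubbardTorus 2 L 1 U) (2 * ⌊(1 - δ) * (L : ℝ) ^ 2 / 2⌋₊) 0 ψ ∧
        star ψ ⬝ᵥ ψ = 1 ∧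
        ((⌊(1 - δ) * (L : ℝ) ^ 2 / 2⌋₊ : ℕ) : ℝ) ^ 2 / (L : ℝ) ^ 2 -
            (star ψ ⬝ᵥ ((∑ z : FermionTorus 2 L, numberOp z 0 * numberOp z 1) *ᵥ ψ)).re ≤
          ε * (L : ℝ) ^ 2) :
    ¬ (∃ Δ : ℝ, 0 < Δ ∧ ∃ L₀ : ℕ, ∀ L ≥ L₀, Even L → ∀ Hm, Hm = hubbardTorus 2 L 1 U →
      2 * Δ ≤ groundEnergy Hm (2 * ⌊(1 - δ) * (L : ℝ) ^ 2 / 2⌋₊ + 1) +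
        groundEnergy Hm (2 * ⌊(1 - δ) * (L : ℝ) ^ 2 / 2⌋₊ - 1) -
        2 * Matrix.minEnergyOn Hm (szSector (2 * ⌊(1 - δ) * (L : ℝ) ^ 2 / 2⌋₊) 0)) := by
  intro hPG
  obtain ⟨d₀, hd₀, L₀, hdef⟩ := doublonDeficit_extensive_of_parityGap_clause hU hδ hPG
  obtain ⟨L, hLne, hL, hev, ψ, hgs, hψ1, hle⟩ := hwick (d₀ / 2) (by positivity) (max L₀ 1)
  have hge := hdef L (le_of_max_le_left hL) hev ψ hgs hψ1
  have hLpos : (0 : ℝ) < (L : ℝ) ^ 2 := by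
    have : (1 : ℝ) ≤ L := by exact_mod_cast le_of_max_le_right hL
    positivity
  nlinarith

/-- **Asymptotically Wick doublon density at every `(U, δ)` refutes `GappedWindow`** (the crux BY
NAME): if at every `U > 0`, `δ ∈ (0, 1/2)` the `(N_L, 0)`-sector ground states have doublon deficit
`o(L²)` along infinitely many even `L`, the window does not exist. -/
theorem not_gappedWindow_of_forall_doublonWick
    (hwick : ∀ (U δ : ℝ), 0 < U → δ ∈ Set.Ioo (0 : ℝ) (1 / 2) →
      ∀ ε : ℝ, 0 < ε → ∀ L₀ : ℕ, ∃ (L : ℕ) (_ : NeZero L), L₀ ≤ L ∧ Even L ∧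
        ∃ ψ : Fock (Orb (FermionTorus 2 L)),
          IsGroundStateInSector (hubbardTorus 2 L 1 U) (2 * ⌊(1 - δ) * (L : ℝ) ^ 2 / 2⌋₊) 0 ψ ∧
          star ψ ⬝ᵥ ψ = 1 ∧
          ((⌊(1 - δ) * (L : ℝ) ^ 2 / 2⌋₊ : ℕ) : ℝ) ^ 2 / (L : ℝ) ^ 2 -
              (star ψ ⬝ᵥ ((∑ z : FermionTorus 2 L, numberOp z 0 * numberOp z 1) *ᵥ ψ)).re ≤
            ε * (L : ℝ) ^ 2) :
    ¬ GappedWindow := by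
  rintro ⟨U, hU, δ, hδ, hPG, -⟩
  exact not_parityGap_clause_of_doublonWick hU hδ (hwick U δ hU hδ) hPG

end Summit.HubbardSuperconductivity.HubbardSuperconductivity.Theorems

end
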